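import Summits.Ventures.HSemireg.HomComplexSigmaConj
import HarnessLib

/-!
# `σ_q` of a strictly perfect complex KILLS GLUING CLASSES: `σ_q^K(Q p ≫ ψ ≫ Q i⟦2⟧) = 0` whenever `i ≫ p = 0`

Cell `pub-hsemireg`, theory seat th-2 (LAW A of `theory/TH2-SIGMA-GLUING-LAWS.md`, kernel form), on the target seat t-7's real carriers
(`HomComplexSigma.lean`: `HomComplex.sigmaC`) and with the SAME ingredients as t-7's `HomComplexSigmaConj.lean` (invariance of `σ_q` under
isomorphisms of complexes).  HONEST FRAMING: kernel plumbing; NOT a door, NOT a named fact, nothing about any variety or conjecture; nothing here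
says HC / HC_CM / HC_AV is proved.

MAIN RESULT (proved): `HomComplex.sigmaC_gluing` — for chain maps `i : K₁• ⟶ K•`, `p : K• ⟶ K₀•` of cochain complexes of `𝒪_X`-modules with
`i ≫ p = 0` (for instance the two maps of a degreewise-split short exact sequence `0 → K₁• → K• → K₀• → 0`, i.e. of a distinguished triangle
of strictly perfect complexes: `K•` is `K₀•` GLUED to `K₁•`), `K₁•`, `K•` bounded in `[a, b]` with finite locally free terms, and ANY class
`ψ : Q K₀• ⟶ (Q K₁•)⟦2⟧`, the «gluing class» `x := Q(p) ≫ ψ ≫ Q(i)⟦2⟧ ∈ Ext²(K•, K•) = Hom_D(Q K•, (Q K•)⟦2⟧)` satisfies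
`σ_q^K(x) = 0` for EVERY `q` — so every such class lies in the joint kernel of all the semiregularity maps, and a nonzero one breaks
`I`-semiregularity for every `I` (`not_isISemiregularC_of_gluing_ne_zero`); `sigmaC_shortComplex_ext_eq_zero` is the short-complex
(`ShortComplex`, `f ≫ g = 0`) spelling.
On paper ([BF03] Def. 4.1, Prop. 3.11, §4): `σ_q(i ψ p) = Tr(At(K)^q ∘ i ψ p) = Tr((i ⊗ 1) At(K₁)^q ψ p) = ± Tr(((p ≫ i) ⊗ 1) At(K₁)^q ψ) = 0`
(naturality of the Atiyah class in the complex, cyclicity/dinaturality of the trace, `i ≫ p = 0`).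

INGREDIENTS (all landed; exactly those of `sigmaC_conj` with `(φ⁻¹, φ)` replaced by `(p, i)` and the punch line `φ⁻¹ ≫ φ = 𝟙` replaced by
`i ≫ p = 0`): naturality of `ι · At^q` (`complexAtiyahPowerFrom_naturality'`, gs-g4), functoriality of `Φ_K` in the second variable
(`shiftedHomMap_mk₀_comp` / `shiftedHomMap_comp_mk₀`, gs-g4), naturality of `Φ` in the FIRST variable (`shiftedHomMap_premap`, t-7 over gs-g4's
`shiftedHomMap_comp_shift_map`), dinaturality of the supertrace (`supertraceH_dinatural`, t-7 over gs-g4's `supertrace_dinatural`), the unit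
naturality `unit_comp_map_eq_unit_comp_premap` (t-7) and bifunctoriality `premap_comp_map` (t-7); additivity of `𝓗om•(K₁•, –)` (`homFunctor_additive`).
KERNEL NOTE: as in `HomComplexSigmaConj.lean`, every composition is spelled so that it is SYNTACTICALLY well-typed (`twistHodgeComplexMap`,
`(premapNatTrans _).app _`, `(homFunctor _).map`); `set_option backward.isDefEq.respectTransparency false` crosses the `homFunctor`-vs-`map` seam.
[cite: BuchweitzFlenner2003, Def. 4.1, Prop. 3.11 and §4 (trace map)]
-/

noncomputable section

open CategoryTheory CategoryTheory.Limits AlgebraicGeometry Opposite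

namespace Summit.Ventures.HSemireg

open Literature.AlgebraicGeometry.Modules Literature.AlgebraicGeometry.Motives
open Summit.HodgeConjecture.HodgeConjecture.Theorems.PadicPridhamSemiregularity

namespace HomComplex

section Gluing

universe w₁ u₁

variable {S : Type u₁} [CommRing S] (X : Over (Spec (CommRingCat.of S))) [HasDerivedCategory.{w₁} X.left.Modules]
  {K₁ K K₀ : CochainComplex X.left.Modules ℤ} (a b : ℤ)
  [K₁.IsStrictlyGE a] [K₁.IsStrictlyLE b] [K.IsStrictlyGE a] [K.IsStrictlyLE b]
  (hK₁ : ∀ n, IsFiniteLocallyFree (K₁.X n)) (hK : ∀ n, IsFiniteLocallyFree (K.X n))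

/-- Step A: the Atiyah argument of a gluing class: `(p · ψ · i) · ι•At^q_K = p · ((ψ · ι•At^q_{K₁}) · (i ⊗ 1))` — naturality of
`ι · At^q` along the chain map `i : K₁• ⟶ K•`. [cite: BuchweitzFlenner2003, Prop. 3.11 and §4 (At^k)] -/
theorem extMulAtiyahPower_gluing (i : K₁ ⟶ K) (p : K ⟶ K₀) (q : ℕ)
    (ψ : ShiftedHom (DerivedCategory.Q.obj K₀) (DerivedCategory.Q.obj K₁) (2 : ℤ)) :
    extMulAtiyahPower X K q
        ((ShiftedHom.mk₀ (0 : ℤ) rfl (DerivedCategory.Q.map p)).comp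
          (ψ.comp (ShiftedHom.mk₀ (0 : ℤ) rfl (DerivedCategory.Q.map i)) (zero_add 2)) (add_zero 2)) =
      (ShiftedHom.mk₀ (0 : ℤ) rfl (DerivedCategory.Q.map p)).comp
        ((ψ.comp (complexAtiyahPowerFrom q K₁) (by ring)).comp
          (ShiftedHom.mk₀ (0 : ℤ) rfl (DerivedCategory.Q.map (twistHodgeComplexMap X q i))) (zero_add _))
        (add_zero _) := by
  rw [extMulAtiyahPower_eq_comp q K, shiftedHom_mk₀_comp_comp, shiftedHom_comp_mk₀_comp,
    ← complexAtiyahPowerFrom_naturality' X q i, shiftedHom_comp_comp_mk₀]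

set_option backward.isDefEq.respectTransparency false in
omit [HasDerivedCategory X.left.Modules] in
/-- Step C, head, at the level of complexes: `unit_K ≫ 𝓗om•(K•, p) ≫ 𝓗om•(i, K₀•) = unit_{K₁} ≫ 𝓗om•(K₁•, i ≫ p) = 0` when `i ≫ p = 0`
(unit naturality `unit_comp_map_eq_unit_comp_premap`, bifunctoriality `premap_comp_map`, additivity of `𝓗om•(K₁•, –)`). [folklore] -/
theorem unit_comp_map_comp_premap_eq_zero (i : K₁ ⟶ K) (p : K ⟶ K₀) (hip : i ≫ p = 0) :
    unit X.left K a b ≫ (homFunctor X.left K).map p ≫ (premapNatTrans X.left i).app K₀ = 0 := by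
  haveI := homFunctor_additive X.left K₁
  have h1 : (premapNatTrans X.left i).app K ≫ (homFunctor X.left K₁).map p =
      (homFunctor X.left K).map p ≫ (premapNatTrans X.left i).app K₀ :=
    premap_comp_map X.left i p
  have h2 : unit X.left K₁ a b ≫ (homFunctor X.left K₁).map i = unit X.left K a b ≫ (premapNatTrans X.left i).app K :=
    unit_comp_map_eq_unit_comp_premap X.left K₁ a b K i
  rw [← h1, ← Category.assoc, ← h2, Category.assoc, ← Functor.map_comp, hip, Functor.map_zero, comp_zero]

set_option backward.isDefEq.respectTransparency false in
/-- Step C, head, in the derived category: `Q(unit_K) ≫ Q(𝓗om•(K•, p)) ≫ Q(𝓗om•(i, K₀•)) = 0` when `i ≫ p = 0`. [folklore] -/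
theorem unitQ_comp_map_comp_premap_eq_zero (i : K₁ ⟶ K) (p : K ⟶ K₀) (hip : i ≫ p = 0) :
    unitQ X K a b ≫ DerivedCategory.Q.map ((homFunctor X.left K).map p) ≫
      DerivedCategory.Q.map ((premapNatTrans X.left i).app K₀) = 0 := by
  unfold unitQ
  rw [← Functor.map_comp, ← Functor.map_comp, unit_comp_map_comp_premap_eq_zero X a b i p hip, Functor.map_zero]

set_option backward.isDefEq.respectTransparency false in
include hK₁ in
/-- **`σ_q` kills gluing classes** (LAW A of the cell's theory sheet `TH2-SIGMA-GLUING-LAWS.md`, on real carriers): for chain maps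
`i : K₁• ⟶ K•` and `p : K• ⟶ K₀•` with `i ≫ p = 0` (`K₁•`, `K•` bounded in `[a, b]` with finite locally free terms) and any
`ψ : Q K₀• ⟶ (Q K₁•)⟦2⟧`, the class `x := Q(p) ≫ ψ ≫ Q(i)⟦2⟧ ∈ Ext²(K•, K•)` has `σ_q^K(x) = 0` in `Hom_D(Q 𝒪_X[0], (Q Ω^q[0])⟦q+2⟧)`.
Proof: Step A (`extMulAtiyahPower_gluing`), functoriality of `Φ_K` (`shiftedHomMap_mk₀_comp` / `shiftedHomMap_comp_mk₀`), dinaturality of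
the supertrace (`supertraceH_dinatural`), naturality of `Φ` in the first variable (`shiftedHomMap_premap`), then the head vanishes
(`unitQ_comp_map_comp_premap_eq_zero`). [cite: BuchweitzFlenner2003, Def. 4.1, Prop. 3.11 and §4 (trace map)] -/
theorem sigmaC_gluing (i : K₁ ⟶ K) (p : K ⟶ K₀) (hip : i ≫ p = 0) (q : ℕ)
    (ψ : ShiftedHom (DerivedCategory.Q.obj K₀) (DerivedCategory.Q.obj K₁) (2 : ℤ)) :
    sigmaC X K a b hK q
        ((ShiftedHom.mk₀ (0 : ℤ) rfl (DerivedCategory.Q.map p)).comp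
          (ψ.comp (ShiftedHom.mk₀ (0 : ℤ) rfl (DerivedCategory.Q.map i)) (zero_add 2)) (add_zero 2)) = 0 := by
  -- Steps A and B: the middle factor
  have hB : phiMulAtiyahPower X K a b hK q
      ((ShiftedHom.mk₀ (0 : ℤ) rfl (DerivedCategory.Q.map p)).comp
        (ψ.comp (ShiftedHom.mk₀ (0 : ℤ) rfl (DerivedCategory.Q.map i)) (zero_add 2)) (add_zero 2)) =
      (ShiftedHom.mk₀ (0 : ℤ) rfl (DerivedCategory.Q.map ((homFunctor X.left K).map p))).comp
        ((shiftedHomMap (homFunctor X.left K) (homFunctor_isInvertedBy X K a b hK)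
            (ψ.comp (complexAtiyahPowerFrom q K₁) (by ring))).comp
          (ShiftedHom.mk₀ (0 : ℤ) rfl (DerivedCategory.Q.map ((homFunctor X.left K).map (twistHodgeComplexMap X q i))))
          (zero_add _)) (add_zero _) := by
    unfold phiMulAtiyahPower
    rw [extMulAtiyahPower_gluing, shiftedHomMap_mk₀_comp, shiftedHomMap_comp_mk₀]
  -- the tail `Q(𝓗om•(K, i ⊗ 1)) ≫ Q(Tr•^H_K) = Q(𝓗om•(i, K₁ ⊗ Ω^q)) ≫ Q(Tr•^H_{K₁})`
  have hT : DerivedCategory.Q.map ((homFunctor X.left K).map (twistHodgeComplexMap X q i)) ≫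
      DerivedCategory.Q.map (supertraceH X K hK q) =
      DerivedCategory.Q.map ((premapNatTrans X.left i).app (twistHodgeComplex X q K₁)) ≫
        DerivedCategory.Q.map (supertraceH X K₁ hK₁ q) := by
    rw [← Functor.map_comp, ← Functor.map_comp, supertraceH_dinatural X hK₁ hK q i]
  unfold sigmaC
  rw [hB, ShiftedHom.mk₀_comp_mk₀_assoc, ← shiftedHom_mk₀_comp_comp, shiftedHom_comp_mk₀_comp_mk₀_cast, hT,
    ← shiftedHom_comp_mk₀_comp_mk₀_cast, shiftedHom_mk₀_comp_comp, shiftedHomMap_premap X i a b hK₁ hK,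
    ShiftedHom.mk₀_comp_mk₀_assoc, Category.assoc, unitQ_comp_map_comp_premap_eq_zero X a b i p hip, ShiftedHom.mk₀_zero,
    ShiftedHom.zero_comp, ShiftedHom.zero_comp]

/-- **Extension classes of a distinguished triangle are `σ`-invisible**: for a short complex `S = (K₁• →f K• →g K₀•)` of cochain complexes
(`f ≫ g = 0`; e.g. a degreewise-split short exact sequence of strictly perfect complexes, i.e. a distinguished triangle `K₁• → K• → K₀• →⁺¹`
with `K•` the middle term GLUED from the outer two), every class `Q(g) ≫ ψ ≫ Q(f)⟦2⟧ ∈ Ext²(K•, K•)` coming from `ψ ∈ Hom_D(Q K₀•, (Q K₁•)⟦2⟧)`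
is killed by every `σ_q` (`sigmaC_gluing` at `(i, p) := (S.f, S.g)`). [cite: BuchweitzFlenner2003, Def. 4.1, Prop. 3.11 and §4 (trace map)] -/
theorem sigmaC_shortComplex_ext_eq_zero (T : ShortComplex (CochainComplex X.left.Modules ℤ))
    [T.X₁.IsStrictlyGE a] [T.X₁.IsStrictlyLE b] [T.X₂.IsStrictlyGE a] [T.X₂.IsStrictlyLE b]
    (h₁ : ∀ n, IsFiniteLocallyFree (T.X₁.X n)) (h₂ : ∀ n, IsFiniteLocallyFree (T.X₂.X n)) (q : ℕ)
    (ψ : ShiftedHom (DerivedCategory.Q.obj T.X₃) (DerivedCategory.Q.obj T.X₁) (2 : ℤ)) :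
    sigmaC X T.X₂ a b h₂ q
        ((ShiftedHom.mk₀ (0 : ℤ) rfl (DerivedCategory.Q.map T.g)).comp
          (ψ.comp (ShiftedHom.mk₀ (0 : ℤ) rfl (DerivedCategory.Q.map T.f)) (zero_add 2)) (add_zero 2)) = 0 :=
  sigmaC_gluing X a b h₁ h₂ T.f T.g T.zero q ψ

include hK₁ in
/-- **A nonzero gluing class breaks `I`-semiregularity, for every `I`**: if some `Q(p) ≫ ψ ≫ Q(i)⟦2⟧ ≠ 0` with `i ≫ p = 0`, then `K•` is
not `I`-semiregular (`IsISemiregularC` = joint injectivity of `(σ_q)_{q ∈ I}`, in its kernel form `isISemiregularC_iff_ker`).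
[cite: BuchweitzFlenner2003, §5 (I-semiregular)] -/
theorem not_isISemiregularC_of_gluing_ne_zero (i : K₁ ⟶ K) (p : K ⟶ K₀) (hip : i ≫ p = 0)
    (ψ : ShiftedHom (DerivedCategory.Q.obj K₀) (DerivedCategory.Q.obj K₁) (2 : ℤ))
    (hx : (ShiftedHom.mk₀ (0 : ℤ) rfl (DerivedCategory.Q.map p)).comp
          (ψ.comp (ShiftedHom.mk₀ (0 : ℤ) rfl (DerivedCategory.Q.map i)) (zero_add 2)) (add_zero 2) ≠ 0)
    (I : Set ℕ) : ¬ IsISemiregularC X K a b hK I := fun h =>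
  hx ((isISemiregularC_iff_ker X K a b hK I).1 h _ fun q _ => sigmaC_gluing X a b hK₁ hK i p hip q ψ)

end Gluing

end HomComplex

end Summit.Ventures.HSemireg

end
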